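import Summits.CriticalPhenomena.SAWScalingLimit.Theorems.SAWSpinMonotoneQCIdentificationXiCycleAux

/-!
# Smirnov's primitive `Ξ = F^{8/5} dz`, V-c: the single boundary cycle — putting back a cut face
(helper sub-goal (O) of `stub_rayCondition`, line `eight_fifths_primitive`, crux `QCIdentification`,
stmt-CriticalPhenomena-16772)

**Setting** (`…XiCycleAux`, `…XiCycleStep`).  The third way of putting back the topmost face `v` of
`T`: `v` has two lower neighbours `w₁ = hexNbr v a`, `w₂ = hexNbr v (a+1)` which are NOT joined in
`T' = T ∖ {v}` — `v` is a cut face, `T'` is the disjoint union of the components `C₁ ∋ w₁`,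
`C₂ ∋ w₂` (`NB.srcComp`), each connected with connected complement, and the boundary cycle of `T`
is obtained from the two cycles of `C₁`, `C₂` by cutting each at its port into `v` and splicing in
the outer port `(v, a+2)` on one side and the link across the site `S` of the corner `a` of `v`
(the arc `A₂ v A₁` of `T` there, `A₁` the arc of `C₁` after `v`, `A₂` the arc of `C₂` before `v`) on
the other.

**What (`xi_split_step`, registered).** Under the flank condition of `T` for `f` away from one port `p₀` and the
induction hypothesis for `C₁` and for `C₂`, `f` equals `f v (a+2)` on every boundary port of `T`.
According to the side of the cut port `p₀`, the induction hypothesis is applied first to the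
component whose half of the cycle is intact (cut at its port into `v`), then to the other one (cut
at `p₀`), the modified function being `f` with the value `f v (a+2)` on the ports pointing into `v`.

Sources: folklore; H. Duminil-Copin, S. Smirnov, Ann. of Math. 175 (2012) 1653–1665, §3; stub report
`STUB-REPORT-rayCondition.md` ((O)).  Validated by enumeration
(`work/stubs/scratch_xi/cycle_induction_check.py`, 370 cut-face steps among 2 859 face sets).
-/

noncomputable section

open Literature.Probability.LatticeModels Literature.Probability.RandomPlanarGeometry
open Literature.Probability.RandomPlanarGeometry.SAW
open Literature.Barriers.CriticalPhenomena Literature.Barriers.CriticalPhenomena.HexKernel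

namespace Summit.CriticalPhenomena.SAWScalingLimit.Cruxes.QCIdentification.EightFifthsPrimitive

namespace Xi

open NB Stokes
open Literature.Probability.Percolation.TriMarkedDomain (fin3_add_one_add_one fin3_add_two_add_one)

/-- **Split step (registered).** Let `v = face S l ∈ T` (`arcCornerIdx l = a`) have `hexNbr v a`,
`hexNbr v (a+1) ∈ T`, `hexNbr v (a+2) ∉ T`, with `hexNbr v a`, `hexNbr v (a+1)` NOT joined in
`T ∖ {v}`, `T` connected; assume the flank condition of `T` for `f` away from `p₀` and the induction
hypothesis for the two components of `T ∖ {v}`.  Then `f` equals `f v (a+2)` on every boundary port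
of `T`. -/
theorem xi_split_step : ∀ {T : Finset HexVertex} {v : HexVertex} {a : Fin 3} {f : HexVertex → Fin 3 → ℝ} {p₀ : HexVertex × Fin 3} {S : Site 2} {l : Fin 6}, v ∈ T → hexNbr v a ∈ T → hexNbr v (a + 1) ∈ T → hexNbr v (a + 2) ∉ T → HexKernel.face S l = v → arcCornerIdx l = a → (∀ (s : Site 2) (j m : Fin 6), m ≠ 0 → HexKernel.face s j ∉ T → (∀ i : Fin 6, i < m → HexKernel.face s (j + 1 + i) ∈ T) → HexKernel.face s (j + 1 + m) ∉ T → (HexKernel.face s (j + 1), arcCornerIdx (j + 1) + 1) ≠ p₀ → f (HexKernel.face s (j + 1)) (arcCornerIdx (j + 1) + 1) = f (HexKernel.face s (j + m)) (arcCornerIdx (j + m))) → (hexGraph.induce (↑T : Set HexVertex)).Preconnected → (∀ (h₁ : hexNbr v a ∈ T.erase v) (h₂ : hexNbr v (a + 1) ∈ T.erase v), ¬(hexGraph.induce (↑(T.erase v) : Set HexVertex)).Reachable ⟨hexNbr v a, Finset.mem_coe.2 h₁⟩ ⟨hexNbr v (a + 1), Finset.mem_coe.2 h₂⟩) → (∀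 b : Fin 3, (b = a ∨ b = a + 1) → ∀ (f' : HexVertex → Fin 3 → ℝ) (p' : HexVertex × Fin 3), (∀ (s : Site 2) (j m : Fin 6), m ≠ 0 → HexKernel.face s j ∉ NB.srcComp (T.erase v) (hexNbr v b) → (∀ i : Fin 6, i < m → HexKernel.face s (j + 1 + i) ∈ NB.srcComp (T.erase v) (hexNbr v b)) → HexKernel.face s (j + 1 + m) ∉ NB.srcComp (T.erase v) (hexNbr v b) → (HexKernel.face s (j + 1), arcCornerIdx (j + 1) + 1) ≠ p' → f' (HexKernel.face s (j + 1)) (arcCornerIdx (j + 1) + 1) = f' (HexKernel.face s (j + m)) (arcCornerIdx (j + m))) → ∀ (x y : HexVertex) (k k' : Fin 3), x ∈ NB.srcComp (T.erase v) (hexNbr v b) → hexNbr x k ∉ NB.srcComp (T.erase v) (hexNbr v b) → y ∈ NB.srcComp (T.erase v) (hexNbr v b) → hexNbr y k' ∉ NB.srcComp (T.erase v) (hexNbr v b) → f' x k = f' y k') → ∀ (x : HexVertex) (k : Fin 3), x ∈ T → hexNbr x k ∉ T → f x k = f v (a + 2) := by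
  intro T v a f p₀ S l hv ha ha1 ha2 hl hκ hL hconn hnj ih
  classical
  -- the two components
  set w₁ := hexNbr v a with hw₁
  set w₂ := hexNbr v (a + 1) with hw₂
  set C₁ := srcComp (T.erase v) w₁ with hC₁
  set C₂ := srcComp (T.erase v) w₂ with hC₂
  have hw₁v : hexNbr w₁ a = v := hexNbr_hexNbr v a
  have hw₂v : hexNbr w₂ (a + 1) = v := hexNbr_hexNbr v (a + 1)
  have hw₁T : w₁ ∈ T.erase v := Finset.mem_erase.2 ⟨(adj_hexNbr v a).ne', ha⟩
  have hw₂T : w₂ ∈ T.erase v := Finset.mem_erase.2 ⟨(adj_hexNbr v (a + 1)).ne', ha1⟩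
  have hw₁C : w₁ ∈ C₁ := mem_srcComp_iff.2 ⟨hw₁T, hw₁T, SimpleGraph.Reachable.refl _⟩
  have hw₂C : w₂ ∈ C₂ := mem_srcComp_iff.2 ⟨hw₂T, hw₂T, SimpleGraph.Reachable.refl _⟩
  have hC₁T : C₁ ⊆ T := fun x hx => Finset.mem_of_mem_erase (srcComp_subset hx)
  have hC₂T : C₂ ⊆ T := fun x hx => Finset.mem_of_mem_erase (srcComp_subset hx)
  have hvC₁ : v ∉ C₁ := fun h => Finset.notMem_erase v T (srcComp_subset h)
  have hvC₂ : v ∉ C₂ := fun h => Finset.notMem_erase v T (srcComp_subset h)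
  have hcl₁ : ∀ x ∈ C₁, ∀ y ∈ T, y ≠ v → hexGraph.Adj x y → y ∈ C₁ :=
    fun x hx y hy hyv hadj => mem_srcComp_of_adj hx (Finset.mem_erase.2 ⟨hyv, hy⟩) hadj
  have hcl₂ : ∀ x ∈ C₂, ∀ y ∈ T, y ≠ v → hexGraph.Adj x y → y ∈ C₂ :=
    fun x hx y hy hyv hadj => mem_srcComp_of_adj hx (Finset.mem_erase.2 ⟨hyv, hy⟩) hadj
  have hdisj : ∀ x, x ∈ C₁ → x ∈ C₂ → False := by
    intro x h1 h2
    obtain ⟨_, _, r1⟩ := mem_srcComp_iff.1 h1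
    obtain ⟨_, _, r2⟩ := mem_srcComp_iff.1 h2
    exact hnj hw₁T hw₂T (r1.trans r2.symm)
  have hcover : ∀ x ∈ T.erase v, x ∈ C₁ ∨ x ∈ C₂ := fun x hx => mem_srcComp_or_of_erase hv hconn ha2 hx
  -- the hexagon at `S`
  have hSl1 : face S (l + 1) = w₁ := by rw [← hexNbr_face_arcCornerIdx, hl, hκ]
  have hSl0 : face S (l - 1) = w₂ := by rw [← hexNbr_face_arcCornerIdx_succ, hl, hκ]
  have hk₁ : arcCornerIdx (l + 1) + 1 = a := by
    by_contra hne
    apply hexNbr_ne w₁ hne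
    rw [hw₁v, ← hSl1, hexNbr_face_arcCornerIdx_succ, add_sub_cancel_right, hl]
  have hk₂ : arcCornerIdx (l - 1) = a + 1 := by
    by_contra hne
    apply hexNbr_ne w₂ hne
    rw [hw₂v, ← hSl0, hexNbr_face_arcCornerIdx, sub_add_cancel, hl]
  -- `A₁`: the arc of `C₁` after `v`
  obtain ⟨m₁, hm₁, hA₁, hA₁e⟩ := xi_exists_arc_from C₁ S l (by rw [hl]; exact hvC₁)
    (by rw [hSl1]; exact hw₁C)
  have hinA₁ : face S (l + m₁) ∈ C₁ := by
    have h := hA₁ (m₁ - 1) (Fin.sub_one_lt_iff.2 ((Fin.pos_iff_ne_zero' _).2 hm₁))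
    rwa [show l + 1 + (m₁ - 1) = l + m₁ by abel] at h
  have hA₁eT : face S (l + 1 + m₁) ∉ T := by
    intro h
    by_cases hev : face S (l + 1 + m₁) = v
    · have e : l + 1 + m₁ = l := (face_inj S _ _).1 (hev.trans hl.symm)
      apply hdisj w₂ _ hw₂C
      rw [← hSl0, show l - 1 = l + 1 + m₁ - 1 by rw [e], show l + 1 + m₁ - 1 = l + m₁ by abel]
      exact hinA₁
    · exact hA₁e (hcl₁ _ hinA₁ _ h hev (by
        have h' := StepLaw.adj_face_succ S (l + m₁)
        rwa [show l + m₁ + 1 = l + 1 + m₁ by abel] at h'))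
  have hinA₁n : hexNbr (face S (l + m₁)) (arcCornerIdx (l + m₁)) ∉ T := by
    rw [hexNbr_face_arcCornerIdx, show l + m₁ + 1 = l + 1 + m₁ by abel]; exact hA₁eT
  -- `A₂`: the arc of `C₂` before `v`
  obtain ⟨j₂, m₂, hm₂, hA₂s, hA₂, hA₂e⟩ := exists_arc_to C₂ S l (by rw [hl]; exact hvC₂)
    (by rw [hSl0]; exact hw₂C)
  have houtA₂ : face S (j₂ + 1) ∈ C₂ := by simpa using hA₂ 0 ((Fin.pos_iff_ne_zero' _).2 hm₂)
  have hA₂sT : face S j₂ ∉ T := by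
    intro h
    by_cases hev : face S j₂ = v
    · have e : j₂ = l := (face_inj S _ _).1 (hev.trans hl.symm)
      apply hdisj w₁ hw₁C
      rw [← hSl1, ← e]; exact houtA₂
    · exact hA₂s (hcl₂ _ houtA₂ _ h hev (by simpa using StepLaw.adj_face_pred S (j₂ + 1)))
  have houtA₂n : hexNbr (face S (j₂ + 1)) (arcCornerIdx (j₂ + 1) + 1) ∉ T := by
    rw [hexNbr_face_arcCornerIdx_succ, add_sub_cancel_right]; exact hA₂sT
  -- the link of `T` across `S`: the arc `A₂ v A₁`, and more generally any `C₂`-arc ending at `v`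
  have hLS : ∀ (j m : Fin 6), m ≠ 0 → face S j ∉ T →
      (∀ i : Fin 6, i < m → face S (j + 1 + i) ∈ C₂) → j + 1 + m = l →
      (face S (j + 1), arcCornerIdx (j + 1) + 1) ≠ p₀ →
      f (face S (j + 1)) (arcCornerIdx (j + 1) + 1) = f (face S (l + m₁)) (arcCornerIdx (l + m₁)) := by
    intro j m hm hjT hi he hne
    have hE : m + 1 + m₁ ≠ 0 := by
      intro h0
      apply hA₁eT
      rw [show l + 1 + m₁ = j + 1 + (m + 1 + m₁) by rw [← he]; abel, h0, add_zero]
      exact hC₂T (by simpa using hi 0 ((Fin.pos_iff_ne_zero' _).2 hm))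
    have h2 : ∀ i : Fin 6, i < m + 1 + m₁ → face S (j + 1 + i) ∈ T := by
      intro i hi'
      rcases fin6_lt_add_one_add m m₁ i hi' with h | h | ⟨i', hi'', rfl⟩
      · exact hC₂T (hi i h)
      · rw [h, he, hl]; exact hv
      · rw [show j + 1 + (m + 1 + i') = l + 1 + i' by rw [← he]; abel]; exact hC₁T (hA₁ i' hi'')
    have h3 : face S (j + 1 + (m + 1 + m₁)) ∉ T := by
      rw [show j + 1 + (m + 1 + m₁) = l + 1 + m₁ by rw [← he]; abel]; exact hA₁eT
    have link := hL S j (m + 1 + m₁) hE hjT h2 h3 hne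
    rwa [show j + (m + 1 + m₁) = l + m₁ by rw [← he]; abel] at link
  -- the modified function
  set c := f v (a + 2) with hc
  set f' : HexVertex → Fin 3 → ℝ := fun x k => if hexNbr x k = v then c else f x k with hf'
  have hf'v : ∀ x k, hexNbr x k = v → f' x k = c := fun x k h => by simp [hf', h]
  have hf'n : ∀ x k, hexNbr x k ≠ v → f' x k = f x k := fun x k h => by simp [hf', h]
  set pv : HexVertex × Fin 3 := (v, a + 2) with hpv
  set pw₁ : HexVertex × Fin 3 := (w₁, a) with hpw₁
  set pw₂ : HexVertex × Fin 3 := (w₂, a + 1) with hpw₂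
  set outA₂ : HexVertex × Fin 3 := (face S (j₂ + 1), arcCornerIdx (j₂ + 1) + 1) with houtA₂def
  -- from constancy of `f'` on a component to the values of `f`
  have concl₁ : ∀ p' : HexVertex × Fin 3,
      (∀ (s : Site 2) (j m : Fin 6), m ≠ 0 → face s j ∉ C₁ →
        (∀ i : Fin 6, i < m → face s (j + 1 + i) ∈ C₁) → face s (j + 1 + m) ∉ C₁ →
        (face s (j + 1), arcCornerIdx (j + 1) + 1) ≠ p' →
        f' (face s (j + 1)) (arcCornerIdx (j + 1) + 1) = f' (face s (j + m)) (arcCornerIdx (j + m))) →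
      ∀ x k, x ∈ C₁ → hexNbr x k ∉ T → f x k = c := by
    intro p' hL₁ x k hx hxk
    rw [← hf'n x k (fun h => hxk (h ▸ hv)), ← hf'v w₁ a hw₁v]
    exact ih a (Or.inl rfl) f' p' hL₁ x w₁ k a hx (fun h => hxk (hC₁T h)) hw₁C
      (by rw [hw₁v]; exact hvC₁)
  have concl₂ : ∀ p' : HexVertex × Fin 3,
      (∀ (s : Site 2) (j m : Fin 6), m ≠ 0 → face s j ∉ C₂ →
        (∀ i : Fin 6, i < m → face s (j + 1 + i) ∈ C₂) → face s (j + 1 + m) ∉ C₂ →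
        (face s (j + 1), arcCornerIdx (j + 1) + 1) ≠ p' →
        f' (face s (j + 1)) (arcCornerIdx (j + 1) + 1) = f' (face s (j + m)) (arcCornerIdx (j + m))) →
      ∀ x k, x ∈ C₂ → hexNbr x k ∉ T → f x k = c := by
    intro p' hL₂ x k hx hxk
    rw [← hf'n x k (fun h => hxk (h ▸ hv)), ← hf'v w₂ (a + 1) hw₂v]
    exact ih (a + 1) (Or.inr rfl) f' p' hL₂ x w₂ k (a + 1) hx (fun h => hxk (hC₂T h)) hw₂C
      (by rw [hw₂v]; exact hvC₂)
  have finish : (∀ x k, x ∈ C₁ → hexNbr x k ∉ T → f x k = c) →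
      (∀ x k, x ∈ C₂ → hexNbr x k ∉ T → f x k = c) →
      ∀ (x : HexVertex) (k : Fin 3), x ∈ T → hexNbr x k ∉ T → f x k = c := by
    intro hB₁ hB₂ x k hx hxk
    by_cases hxv : x = v
    · rw [hxv] at hxk ⊢
      rcases fin3_trichotomy a k with rfl | rfl | rfl
      · exact absurd ha hxk
      · exact absurd ha1 hxk
      · rfl
    · rcases hcover x (Finset.mem_erase.2 ⟨hxv, hx⟩) with h | h
      · exact hB₁ x k h hxk
      · exact hB₂ x k h hxk
  -- the local obligations shared by both cases
  -- (i) arcs of `C₂` starting right after `v` sit at the corner `a + 1` and link to `(v, a+2)`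
  have start₂ : ∀ (p' : HexVertex × Fin 3) (s : Site 2) (j m : Fin 6), m ≠ 0 → face s j = v →
      (∀ i : Fin 6, i < m → face s (j + 1 + i) ∈ C₂) → face s (j + 1 + m) ∉ C₂ →
      face s (j + 1 + m) ≠ v → (face s (j + 1), arcCornerIdx (j + 1) + 1) ≠ p' →
      (p₀ = pv → p' = pw₂) → c = f (face s (j + m)) (arcCornerIdx (j + m)) := by
    intro p' s j m hm hvj hi hjm hvl hne hp
    have h0 : (0 : Fin 6) < m := (Fin.pos_iff_ne_zero' m).2 hm
    have hj1 : face s (j + 1) ∈ C₂ := by simpa using hi 0 h0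
    have e1 : hexNbr v (arcCornerIdx j) = face s (j + 1) := by
      rw [← hvj]; exact hexNbr_face_arcCornerIdx s j
    rcases fin3_trichotomy a (arcCornerIdx j) with h | h | h
    · obtain ⟨rfl, rfl⟩ := site_eq_of_face_eq (hvj.trans hl.symm) (h.trans hκ.symm)
      exact (hdisj w₁ hw₁C (by rw [← hSl1]; exact hj1)).elim
    · have hp₀ : p₀ ≠ pv := by
        intro hp0
        apply hne
        rw [hp hp0]
        have hfw : face s (j + 1) = w₂ := by rw [← e1, h]
        have hk : arcCornerIdx (j + 1) + 1 = a + 1 := by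
          by_contra hne'
          apply hexNbr_ne w₂ hne'
          rw [hw₂v, ← hfw, hexNbr_face_arcCornerIdx_succ, add_sub_cancel_right, hvj]
        rw [hfw, hk]
      have hm1 : m + 1 ≠ 0 := by
        intro h0'
        apply hvl
        rw [show j + 1 + m = j + (m + 1) by abel, h0', add_zero, hvj]
      have hmC : face s (j + m) ∈ C₂ := by
        have h' := hi (m - 1) (Fin.sub_one_lt_iff.2 h0)
        rwa [show j + 1 + (m - 1) = j + m by abel] at h'
      have h1 : face s (j - 1) ∉ T := by
        rw [← hexNbr_face_arcCornerIdx_succ s j, hvj, h, fin3_add_one_add_one]; exact ha2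
      have h2 : ∀ i : Fin 6, i < m + 1 → face s (j - 1 + 1 + i) ∈ T := by
        intro i hi'
        rw [sub_add_cancel]
        rcases fin6_lt_add_one_add 0 m i (by rw [zero_add, add_comm]; exact hi') with
          h' | h' | ⟨i', hi'', rfl⟩
        · exact absurd h' (fin6_not_lt_zero i)
        · rw [h', add_zero, hvj]; exact hv
        · rw [show j + (0 + 1 + i') = j + 1 + i' by abel]; exact hC₂T (hi i' hi'')
      have h3 : face s (j - 1 + 1 + (m + 1)) ∉ T := by
        rw [sub_add_cancel, show j + (m + 1) = j + 1 + m by abel]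
        exact fun h' => hjm (hcl₂ _ hmC _ h' hvl (by
          have h'' := StepLaw.adj_face_succ s (j + m)
          rwa [show j + m + 1 = j + 1 + m by abel] at h''))
      have h4 : (face s (j - 1 + 1), arcCornerIdx (j - 1 + 1) + 1) ≠ p₀ := by
        rw [sub_add_cancel, hvj, h, fin3_add_one_add_one]
        exact fun h' => hp₀ h'.symm
      have link := hL s (j - 1) (m + 1) hm1 h1 h2 h3 h4
      rw [sub_add_cancel, hvj, h, fin3_add_one_add_one, show j - 1 + (m + 1) = j + m by abel]
        at link
      rw [hc, link]
    · exact absurd (hC₂T (by rw [← e1, h] at hj1; exact hj1)) ha2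
  -- (ii) arcs of `C₁` ending right before `v` sit at the corner `a + 2` and link to `(v, a+2)`
  have end₁ : ∀ (p' : HexVertex × Fin 3) (s : Site 2) (j m : Fin 6), m ≠ 0 → face s j ∉ C₁ →
      face s j ≠ v → (∀ i : Fin 6, i < m → face s (j + 1 + i) ∈ C₁) → face s (j + 1 + m) = v →
      (face s (j + 1), arcCornerIdx (j + 1) + 1) ≠ p' → (p' = p₀ ∨ p₀ = pv ∨ p₀.1 ∈ C₂) →
      f (face s (j + 1)) (arcCornerIdx (j + 1) + 1) = c := by
    intro p' s j m hm hj hvj hi hvl hne hp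
    have h0 : (0 : Fin 6) < m := (Fin.pos_iff_ne_zero' m).2 hm
    have hj1 : face s (j + 1) ∈ C₁ := by simpa using hi 0 h0
    have hmC : face s (j + m) ∈ C₁ := by
      have h := hi (m - 1) (Fin.sub_one_lt_iff.2 h0)
      rwa [show j + 1 + (m - 1) = j + m by abel] at h
    have e1 : hexNbr v (arcCornerIdx (j + 1 + m) + 1) = face s (j + m) := by
      rw [← hvl, hexNbr_face_arcCornerIdx_succ, show j + 1 + m - 1 = j + m by abel]
    rcases fin3_trichotomy a (arcCornerIdx (j + 1 + m)) with h | h | h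
    · obtain ⟨rfl, e⟩ := site_eq_of_face_eq (hvl.trans hl.symm) (h.trans hκ.symm)
      refine (hdisj w₂ ?_ hw₂C).elim
      rw [← hSl0, show l - 1 = j + m by rw [← e]; abel]; exact hmC
    · exact absurd (hC₁T (by rw [← fin3_add_one_add_one, ← h, e1]; exact hmC)) ha2
    · have hm1 : m + 1 ≠ 0 := by
        intro h0'
        apply hvj
        rw [← hvl, show j + 1 + m = j + (m + 1) by abel, h0', add_zero]
      have hjT : face s j ∉ T := fun h' =>
        hj (hcl₁ _ hj1 _ h' hvj (by simpa using StepLaw.adj_face_pred s (j + 1)))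
      have h2 : ∀ i : Fin 6, i < m + 1 → face s (j + 1 + i) ∈ T := by
        intro i hi'
        rcases fin6_lt_add_one_add m 0 i (by simpa using hi') with h' | h' | ⟨i', hi'', -⟩
        · exact hC₁T (hi i h')
        · rw [h', hvl]; exact hv
        · exact absurd hi'' (fin6_not_lt_zero i')
      have h3 : face s (j + 1 + (m + 1)) ∉ T := by
        rw [show j + 1 + (m + 1) = j + 1 + m + 1 by abel, ← hexNbr_face_arcCornerIdx, hvl, h]
        exact ha2
      have h4 : (face s (j + 1), arcCornerIdx (j + 1) + 1) ≠ p₀ := by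
        rcases hp with rfl | hp | hp
        · exact hne
        · rw [hp]; exact fun e => hvC₁ (by rw [← show face s (j + 1) = v from congrArg Prod.fst e]; exact hj1)
        · exact fun e => hdisj _ hj1 (by rw [show face s (j + 1) = p₀.1 from congrArg Prod.fst e]; exact hp)
      have link := hL s j (m + 1) hm1 hjT h2 h3 h4
      rw [show j + (m + 1) = j + 1 + m by abel, hvl, h] at link
      exact link
  by_cases hB : p₀ = pv ∨ (p₀.1 ∈ C₂ ∧ p₀ ≠ outA₂)
  · -- the cut port is on the `C₂` side: first `C₁` (cut at `pw₁`), then `C₂`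
    have hB₁ := concl₁ pw₁ (links_transfer (X := C₁) (f' := f') (p' := pw₁) hC₁T hcl₁ hL ?_ hf'v
      hf'n ?_ ?_)
    rotate_left
    · right
      rcases hB with h | ⟨h, -⟩
      · rw [h]; exact hvC₁
      · exact fun h' => hdisj _ h' h
    · -- arcs of `C₁` starting right after `v`: only `A₁`, whose out-flank is `pw₁`
      intro s j m hm hvj hi hjm hvl hne
      have h0 : (0 : Fin 6) < m := (Fin.pos_iff_ne_zero' m).2 hm
      have hj1 : face s (j + 1) ∈ C₁ := by simpa using hi 0 h0
      have e1 : hexNbr v (arcCornerIdx j) = face s (j + 1) := by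
        rw [← hvj]; exact hexNbr_face_arcCornerIdx s j
      rcases fin3_trichotomy a (arcCornerIdx j) with h | h | h
      · obtain ⟨rfl, rfl⟩ := site_eq_of_face_eq (hvj.trans hl.symm) (h.trans hκ.symm)
        exact absurd (by rw [hSl1, hk₁]) hne
      · exact (hdisj w₂ (by rw [hw₂, ← h, e1]; exact hj1) hw₂C).elim
      · exact absurd (hC₁T (by rw [← e1, h] at hj1; exact hj1)) ha2
    · intro s j m hm hj hvj hi hvl hne
      exact end₁ pw₁ s j m hm hj hvj hi hvl hne (Or.inr (by
        rcases hB with h | ⟨h, -⟩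
        · exact Or.inl h
        · exact Or.inr h))
    have hcA₁ : f (face S (l + m₁)) (arcCornerIdx (l + m₁)) = c := hB₁ _ _ hinA₁ hinA₁n
    set p₂ : HexVertex × Fin 3 := if p₀ = pv then pw₂ else p₀ with hp₂
    have hB₂ := concl₂ p₂ (links_transfer (X := C₂) (f' := f') (p' := p₂) hC₂T hcl₂ hL ?_ hf'v
      hf'n ?_ ?_)
    rotate_left
    · by_cases h : p₀ = pv
      · right; rw [h]; exact hvC₂
      · left; rw [hp₂, if_neg h]
    · intro s j m hm hvj hi hjm hvl hne
      exact start₂ p₂ s j m hm hvj hi hjm hvl hne (fun h => by rw [hp₂, if_pos h])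
    · -- arcs of `C₂` ending right before `v`: at `S`, linked across `S` to `A₁`
      intro s j m hm hj hvj hi hvl hne
      have h0 : (0 : Fin 6) < m := (Fin.pos_iff_ne_zero' m).2 hm
      have hj1 : face s (j + 1) ∈ C₂ := by simpa using hi 0 h0
      have hmC : face s (j + m) ∈ C₂ := by
        have h := hi (m - 1) (Fin.sub_one_lt_iff.2 h0)
        rwa [show j + 1 + (m - 1) = j + m by abel] at h
      have e1 : hexNbr v (arcCornerIdx (j + 1 + m) + 1) = face s (j + m) := by
        rw [← hvl, hexNbr_face_arcCornerIdx_succ, show j + 1 + m - 1 = j + m by abel]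
      rcases fin3_trichotomy a (arcCornerIdx (j + 1 + m)) with h | h | h
      · obtain ⟨hsS, e⟩ := site_eq_of_face_eq (hvl.trans hl.symm) (h.trans hκ.symm)
        subst hsS
        have hjT : face s j ∉ T := fun h' =>
          hj (hcl₂ _ hj1 _ h' hvj (by simpa using StepLaw.adj_face_pred s (j + 1)))
        have h4 : (face s (j + 1), arcCornerIdx (j + 1) + 1) ≠ p₀ := by
          by_cases hp : p₀ = pv
          · rw [hp]
            exact fun e' => hvC₂ (by
              rw [← show face s (j + 1) = v from congrArg Prod.fst e']; exact hj1)
          · rwa [hp₂, if_neg hp] at hne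
        rw [hLS j m hm hjT hi e h4, hcA₁]
      · exact absurd (hC₂T (by rw [← fin3_add_one_add_one, ← h, e1]; exact hmC)) ha2
      · refine (hdisj w₁ hw₁C ?_).elim
        rw [hw₁, ← fin3_add_two_add_one a, ← h, e1]; exact hmC
    exact finish hB₁ hB₂
  · -- the cut port is on the `C₁` side (or nowhere): first `C₂` (cut at `outA₂`), then `C₁`
    push Not at hB
    have hB₂ := concl₂ outA₂ (links_transfer (X := C₂) (f' := f') (p' := outA₂) hC₂T hcl₂ hL ?_
      hf'v hf'n ?_ ?_)
    rotate_left
    · by_cases h : p₀.1 ∈ C₂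
      · left; exact (hB.2 h).symm
      · right; exact h
    · intro s j m hm hvj hi hjm hvl hne
      exact start₂ outA₂ s j m hm hvj hi hjm hvl hne (fun h => absurd h hB.1)
    · -- arcs of `C₂` ending right before `v`: only `A₂`, whose out-flank is `outA₂`
      intro s j m hm hj hvj hi hvl hne
      have h0 : (0 : Fin 6) < m := (Fin.pos_iff_ne_zero' m).2 hm
      have hmC : face s (j + m) ∈ C₂ := by
        have h := hi (m - 1) (Fin.sub_one_lt_iff.2 h0)
        rwa [show j + 1 + (m - 1) = j + m by abel] at h
      have e1 : hexNbr v (arcCornerIdx (j + 1 + m) + 1) = face s (j + m) := by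
        rw [← hvl, hexNbr_face_arcCornerIdx_succ, show j + 1 + m - 1 = j + m by abel]
      rcases fin3_trichotomy a (arcCornerIdx (j + 1 + m)) with h | h | h
      · obtain ⟨rfl, e⟩ := site_eq_of_face_eq (hvl.trans hl.symm) (h.trans hκ.symm)
        have hjj : j = j₂ := arc_unique_end hj hi hA₂s hA₂ (e.trans hA₂e.symm)
        exact absurd (by rw [hjj]) hne
      · exact absurd (hC₂T (by rw [← fin3_add_one_add_one, ← h, e1]; exact hmC)) ha2
      · refine (hdisj w₁ hw₁C ?_).elim
        rw [hw₁, ← fin3_add_two_add_one a, ← h, e1]; exact hmC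
    have hcA₂ : f (face S (j₂ + 1)) (arcCornerIdx (j₂ + 1) + 1) = c := hB₂ _ _ houtA₂ houtA₂n
    set p₁ : HexVertex × Fin 3 := if p₀ = outA₂ then pw₁ else p₀ with hp₁
    have hB₁ := concl₁ p₁ (links_transfer (X := C₁) (f' := f') (p' := p₁) hC₁T hcl₁ hL ?_ hf'v
      hf'n ?_ ?_)
    rotate_left
    · by_cases h : p₀ = outA₂
      · right; rw [h]; exact fun h' => hdisj _ h' houtA₂
      · left; rw [hp₁, if_neg h]
    · -- arcs of `C₁` starting right after `v`: only `A₁`, linked across `S` to `outA₂`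
      intro s j m hm hvj hi hjm hvl hne
      have h0 : (0 : Fin 6) < m := (Fin.pos_iff_ne_zero' m).2 hm
      have hj1 : face s (j + 1) ∈ C₁ := by simpa using hi 0 h0
      have e1 : hexNbr v (arcCornerIdx j) = face s (j + 1) := by
        rw [← hvj]; exact hexNbr_face_arcCornerIdx s j
      rcases fin3_trichotomy a (arcCornerIdx j) with h | h | h
      · obtain ⟨rfl, rfl⟩ := site_eq_of_face_eq (hvj.trans hl.symm) (h.trans hκ.symm)
        have hp0 : p₀ ≠ outA₂ := by
          intro hp
          apply hne
          rw [hp₁, if_pos hp, hSl1, hk₁]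
        have hmm : m = m₁ := arc_unique_start hi hjm hA₁ hA₁e
        rw [hmm, ← hLS j₂ m₂ hm₂ hA₂sT hA₂ hA₂e (fun h' => hp0 h'.symm), hcA₂]
      · exact (hdisj w₂ (by rw [hw₂, ← h, e1]; exact hj1) hw₂C).elim
      · exact absurd (hC₁T (by rw [← e1, h] at hj1; exact hj1)) ha2
    · intro s j m hm hj hvj hi hvl hne
      refine end₁ p₁ s j m hm hj hvj hi hvl hne ?_
      by_cases h : p₀ = outA₂
      · exact Or.inr (Or.inr (by rw [h]; exact houtA₂))
      · exact Or.inl (by rw [hp₁, if_neg h])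
    exact finish hB₁ hB₂

end Xi

end Summit.CriticalPhenomena.SAWScalingLimit.Cruxes.QCIdentification.EightFifthsPrimitive

end
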